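import Summits.NavierStokesRegularity.FluidComputer.PalasekTowerRegisterGlobalExactSlice
import Summits.NavierStokesRegularity.FluidComputer.PalasekTowerRegisterGlobalDesignExact
import Summits.NavierStokesRegularity.FluidComputer.PalasekTowerRescaledCopy

/-!
# REGISTER v2.3′: the EXACT-SLICE form of the first episode — `FirstEpisodeD (exact S₀)` ⇔ an admissible push
# and ONE run from the host's slice `u(τ₀)` over the first growth window

Cell `ns-blowup`, seat `ns-blowup-ecbridge-4` (g5; GROUP C «BRIDGE SUPPORT»; stub `first_episode` of the crux
`EpisodeBase` = `EpisodeBaseG`, item stmt-NavierStokesRegularity-19179, supports only). Sequel of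
`PalasekTowerRegisterGlobalExactSlice.lean` (this seat: a bounded finite-energy classical run from the slice
under the window force IS a continuation, every level — `Stage.levelWitness_of_sliceRun`,
`Stage.exists_extends_of_sliceRun`), of `PalasekTowerRegisterGlobalDesignExact.lean` (this seat, g2: the
singleton class `HostClass.exact S₀`, `firstEpisodeD_exact_of_levelWitness` = the DATUM form, re-run from
`t = 0`) and of ecbridge-6's `PalasekTowerHeredityWitnessWindowBase.lean` (the `ε`-overlap window form of the
rungs and the base). LABEL: E–C typing (KERNEL plumbing: theorems only, no definition, no named fact). WHAT
THIS IS NOT: not Navier–Stokes evidence — no stage, host, push, flow or tower is constructed;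
`FirstEpisodeD`, `EpisodeBaseG`, `RungG` stay OPEN and appear only as conclusions of conditionals or inside
equivalences.

* §3 `firstEpisodeD_exact_of_sliceRun` (⇐: a pinned rigid `S₀` with a registered host `s₀`, a push constant
  `c ≤ c₁` and an ADMISSIBLE PUSH `g` — Clay class, `= S₀.f` on `[0, τ₀]`, silent from `τ₁`, confined to the
  ball, `‖g‖ ≤ c Y_k` on the windows — and ONE classical finite-energy solution of Navier–Stokes at unit
  viscosity forced by `g` on `[τ₀, τ₁]` FROM THE SLICE `s₀.u τ₀`, below `c₂ Y₁`, with the level-`1` letter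
  at `τ₁`), `FirstEpisodeD.exact_sliceRun` (⇒), `firstEpisodeD_exact_iff_exists_sliceRun`, and the push-free
  case `firstEpisodeD_exact_of_sliceRun_self` (quiet `S₀`, run under `S₀.f` itself).
* §4 `rungG_succ_iff_exists_sliceRun`, `episodeBaseG_iff_exists_sliceRun_zero` — the `ε = 0` twins of
  `rungG_succ_iff_exists_window_solution` / `episodeBaseG_iff_exists_window_solution_zero`.

READING (item 19179): given host preparation, the first episode of a NAMED design `S₀` depends on the host
ONLY THROUGH ITS SLICE `u(τ₀)` and the push chosen on the window: ONE Cauchy problem — Navier–Stokes at unit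
viscosity from the smooth finite-energy field `u(τ₀)`, forced by the admissible push on `[τ₀, τ₁]`,
`τ₁ − τ₀ = (253/25) log N₁ / A₀ ≈ 1.8·10⁻⁴` (`Schedule.Rigid.window_length`) — must have a classical solution
below `(5/3) Y₁ ≈ 4630` showing at `τ₁` speed `≥ Y₁ ≈ 2778`, gradient `≥ A₁ ≈ 1.24·10⁶` and an `N₁`-core in
the ball. For the explicit germ designs of seat ecbridge-3 the slice at `τ₀ = 1` is the profile `U` itself
(`Germ.lineVel U σ₀ 1 = U`). Nothing here says such a run exists for any design.

References: S. Palasek, arXiv:2605.13827 §4 [cite: Palasek2026ElementaryModel, §4]; H. Sohr, *The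
Navier–Stokes Equations*, Birkhäuser 2001, Ch. V Thm. 1.5.1 [cite: Sohr2001, Ch. V Thm. 1.5.1].
-/

noncomputable section

namespace Summit.NavierStokesRegularity.FluidComputer.PalasekTowerClayBridge

open Set MeasureTheory Filter Topology Function Real
open scoped ENNReal ContDiff NNReal
open Literature.Analysis.FluidPDE

/-! ## §3 The first episode over a singleton class in exact-slice form (`k = 0`, wide rates, `ν = 1`) -/

/-- **THE FIRST EPISODE OF A NAMED DESIGN FROM ONE SLICE RUN UNDER THE CHOSEN PUSH.** Let `S₀` be a
pinned (`Λ = 8`, `θ = 6/5`), rigid schedule on the wide-base rates with a registered host `s₀` (globally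
anchored level-`0` stage), `c ≤ c₁` a push constant and `g` an ADMISSIBLE PUSH — Clay-smooth with
Fefferman's decay, silent from `T`, `‖g‖ ≤ c Y_k` on the growth windows, EQUAL to `S₀.f` on the host's
slab `[0, τ 0] × ℝ³`, SILENT from `τ 1` on, CONFINED to the ball. Suppose ONE classical solution
`(v, q)` of Navier–Stokes at unit viscosity forced by `g` on the first growth window `[τ 0, τ 1]` starts
AT THE HOST'S SLICE `v (τ 0) = s₀.u (τ 0)`, has finite energy, stays below `c₂ Y₁` and shows at `τ 1`
the level-`1` letter in the ball (speed `≥ c₁ Y₁`, gradient `≥ c₁ A₁`, an `N₁`-core loop with circulation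
`≥ c₁ N₁^{β−2}`). Then `FirstEpisodeD (HostClass.exact S₀)`: the re-pushed schedule is pinned
(`Schedule.Rigid.pins_repush_of_le_c₁`), rigid and quiet, every host of `S₀` transports to it
(`Stage.repushG`), the run from the slice is a level witness of the re-pushed design
(`Stage.levelWitness_of_sliceRun`, §2), and one level witness closes the singleton class
(`firstEpisodeD_exact_of_levelWitness`). [cite: Palasek2026ElementaryModel, §4] [cite: Sohr2001, Ch. V Thm. 1.5.1] -/
theorem firstEpisodeD_exact_of_sliceRun {S₀ : Schedule TowerRates.wide} (hP : S₀.Pins 8 (6 / 5))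
    (hR : S₀.Rigid) (s₀ : Stage 1 TowerRates.wide S₀ (Margins.routeG TowerRates.wide) 0)
    {c : ℝ} (hc : c ≤ S₀.c₁) {g : ℝ → EuclideanSpace ℝ (Fin 3) → EuclideanSpace ℝ (Fin 3)}
    (h₁ : IsSmoothOnHalfSpace g) (h₂ : HasRapidSpaceTimeDecay g)
    (h₃ : ∀ t, S₀.T ≤ t → ∀ x, g t x = 0)
    (h₄ : ∀ k, ∀ t ∈ Icc (S₀.τ k) (S₀.τ (k + 1)), ∀ x, ‖g t x‖ ≤ c * TowerRates.wide.Y k)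
    (hg : ∀ t ∈ Icc 0 (S₀.τ 0), ∀ x, g t x = S₀.f t x) (hsilent : ∀ t, S₀.τ 1 ≤ t → g t = 0)
    (hconf : ∀ t x, S₀.radius < ‖x‖ → g t x = 0)
    {v : ℝ → EuclideanSpace ℝ (Fin 3) → EuclideanSpace ℝ (Fin 3)} {q : ℝ → EuclideanSpace ℝ (Fin 3) → ℝ}
    (hv : IsClassicalNSSolutionOn (Icc (S₀.τ 0) (S₀.τ 1)) 1 g v q) (hv0 : v (S₀.τ 0) = s₀.u (S₀.τ 0))
    (hEv : ∃ C : ℝ≥0∞, C < ⊤ ∧ ∀ t ∈ Icc (S₀.τ 0) (S₀.τ 1), ∫⁻ x, ‖v t x‖ₑ ^ 2 ≤ C)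
    (hceil : ∀ t ∈ Icc (S₀.τ 0) (S₀.τ 1), ∀ x, ‖v t x‖ ≤ S₀.c₂ * TowerRates.wide.Y 1)
    (hletter : Letter S₀ 1 (v (S₀.τ 1))) : FirstEpisodeD (HostClass.exact S₀) := by
  obtain ⟨hfloor, hstrain, hcore⟩ := hletter
  have hP' : (S₀.repush c hc g h₁ h₂ h₃ h₄).Pins 8 (6 / 5) := hR.pins_repush_of_le_c₁ hP hconf
  have hR' : (S₀.repush c hc g h₁ h₂ h₃ h₄).Rigid := hR.repush
  have hQ' : (S₀.repush c hc g h₁ h₂ h₃ h₄).Quiet := hsilent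
  have hW : (S₀.repush c hc g h₁ h₂ h₃ h₄).LevelWitness 1 0 :=
    (s₀.repushG c hc g h₁ h₂ h₃ h₄ hg).levelWitness_of_sliceRun one_pos hv hv0 hEv hceil hfloor hstrain
      hcore
  exact firstEpisodeD_exact_of_levelWitness hc h₁ h₂ h₃ h₄ hg hP' hR' hQ' hW

/-- **Converse: the first episode over the singleton class hands back an admissible push and a slice run**
(free direction): for a pinned rigid quiet `S₀` with a registered host `s₀`, `FirstEpisodeD (exact S₀)`
gives `c ≤ c₁`, an admissible push `g` (`= S₀.f` on `[0, τ 0]`, silent from `τ 1`, confined) and a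
classical finite-energy solution on `[τ 0, τ 1]` under `g` from the slice `s₀.u (τ 0)`, below `c₂ Y₁`,
with the level-`1` letter at `τ 1` (the level-`1` stage read from `τ 0` on). [folklore] -/
theorem FirstEpisodeD.exact_sliceRun {S₀ : Schedule TowerRates.wide}
    (h : FirstEpisodeD (HostClass.exact S₀)) (hP : S₀.Pins 8 (6 / 5)) (hR : S₀.Rigid) (hQ : S₀.Quiet)
    (s₀ : Stage 1 TowerRates.wide S₀ (Margins.routeG TowerRates.wide) 0) :
    ∃ (c : ℝ) (_ : c ≤ S₀.c₁) (g : ℝ → EuclideanSpace ℝ (Fin 3) → EuclideanSpace ℝ (Fin 3)),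
      IsSmoothOnHalfSpace g ∧ HasRapidSpaceTimeDecay g ∧ (∀ t, S₀.T ≤ t → ∀ x, g t x = 0) ∧
      (∀ k, ∀ t ∈ Icc (S₀.τ k) (S₀.τ (k + 1)), ∀ x, ‖g t x‖ ≤ c * TowerRates.wide.Y k) ∧
      (∀ t ∈ Icc 0 (S₀.τ 0), ∀ x, g t x = S₀.f t x) ∧ (∀ t, S₀.τ 1 ≤ t → g t = 0) ∧
      (∀ t x, S₀.radius < ‖x‖ → g t x = 0) ∧
      ∃ (v : ℝ → EuclideanSpace ℝ (Fin 3) → EuclideanSpace ℝ (Fin 3))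
        (q : ℝ → EuclideanSpace ℝ (Fin 3) → ℝ),
        IsClassicalNSSolutionOn (Icc (S₀.τ 0) (S₀.τ 1)) 1 g v q ∧ v (S₀.τ 0) = s₀.u (S₀.τ 0) ∧
        (∃ C : ℝ≥0∞, C < ⊤ ∧ ∀ t ∈ Icc (S₀.τ 0) (S₀.τ 1), ∫⁻ x, ‖v t x‖ₑ ^ 2 ≤ C) ∧
        (∀ t ∈ Icc (S₀.τ 0) (S₀.τ 1), ∀ x, ‖v t x‖ ≤ S₀.c₂ * TowerRates.wide.Y 1) ∧
        Letter S₀ 1 (v (S₀.τ 1)) := by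
  obtain ⟨c, hc, g, h₁, h₂, h₃, h₄, hg, hP', -, hQ', s₁, hs₁⟩ := h S₀ hP hR hQ s₀ rfl
  obtain ⟨hcl, h0, hE, hceil, hfloor, hstrain, hcore⟩ :=
    Stage.Extends.sliceRun (s := s₀.repushG c hc g h₁ h₂ h₃ h₄ hg) (s' := s₁) hs₁
  exact ⟨c, hc, g, h₁, h₂, h₃, h₄, hg, hQ', hP'.force_confined, s₁.u, s₁.p, hcl, h0, hE, hceil,
    hfloor, hstrain, hcore⟩

/-- **`FirstEpisodeD (exact S₀)` ⇔ ∃ admissible push ∃ ONE slice run** (for a pinned rigid quiet `S₀`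
with a registered host `s₀`; all hosts of `S₀` share the slice, `HostClass.exact_velocity_eq`): the first
episode of the named design is the statement that, for some admissible push `g` on the window (equal to
the design force on the host's slab, silent from `τ 1`, confined, `‖g‖ ≤ c Y_k`, `c ≤ c₁ = 1`), the
Navier–Stokes system at unit viscosity forced by `g` has a classical finite-energy solution on
`[τ 0, τ 1]` FROM THE SLICE `s₀.u (τ 0)` staying below `c₂ Y₁ = (5/3) Y₁` and showing the level-`1`
letter at `τ 1`. [cite: Palasek2026ElementaryModel, §4] [cite: Sohr2001, Ch. V Thm. 1.5.1] -/
theorem firstEpisodeD_exact_iff_exists_sliceRun {S₀ : Schedule TowerRates.wide} (hP : S₀.Pins 8 (6 / 5))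
    (hR : S₀.Rigid) (hQ : S₀.Quiet)
    (s₀ : Stage 1 TowerRates.wide S₀ (Margins.routeG TowerRates.wide) 0) :
    FirstEpisodeD (HostClass.exact S₀) ↔
      ∃ (c : ℝ) (_ : c ≤ S₀.c₁) (g : ℝ → EuclideanSpace ℝ (Fin 3) → EuclideanSpace ℝ (Fin 3)),
        IsSmoothOnHalfSpace g ∧ HasRapidSpaceTimeDecay g ∧ (∀ t, S₀.T ≤ t → ∀ x, g t x = 0) ∧
        (∀ k, ∀ t ∈ Icc (S₀.τ k) (S₀.τ (k + 1)), ∀ x, ‖g t x‖ ≤ c * TowerRates.wide.Y k) ∧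
        (∀ t ∈ Icc 0 (S₀.τ 0), ∀ x, g t x = S₀.f t x) ∧ (∀ t, S₀.τ 1 ≤ t → g t = 0) ∧
        (∀ t x, S₀.radius < ‖x‖ → g t x = 0) ∧
        ∃ (v : ℝ → EuclideanSpace ℝ (Fin 3) → EuclideanSpace ℝ (Fin 3))
          (q : ℝ → EuclideanSpace ℝ (Fin 3) → ℝ),
          IsClassicalNSSolutionOn (Icc (S₀.τ 0) (S₀.τ 1)) 1 g v q ∧ v (S₀.τ 0) = s₀.u (S₀.τ 0) ∧
          (∃ C : ℝ≥0∞, C < ⊤ ∧ ∀ t ∈ Icc (S₀.τ 0) (S₀.τ 1), ∫⁻ x, ‖v t x‖ₑ ^ 2 ≤ C) ∧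
          (∀ t ∈ Icc (S₀.τ 0) (S₀.τ 1), ∀ x, ‖v t x‖ ≤ S₀.c₂ * TowerRates.wide.Y 1) ∧
          Letter S₀ 1 (v (S₀.τ 1)) := by
  constructor
  · intro h
    exact h.exact_sliceRun hP hR hQ s₀
  · rintro ⟨c, hc, g, h₁, h₂, h₃, h₄, hg, hsilent, hconf, v, q, hv, hv0, hEv, hceil, hletter⟩
    exact firstEpisodeD_exact_of_sliceRun hP hR s₀ hc h₁ h₂ h₃ h₄ hg hsilent hconf hv hv0 hEv hceil
      hletter

/-- **The push-free case**: if the named design `S₀` (pinned, rigid, QUIET) already carries its push, one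
classical finite-energy run on `[τ 0, τ 1]` under `S₀.f` itself from the host's slice, below `c₂ Y₁`, with
the level-`1` letter, gives `FirstEpisodeD (exact S₀)` (re-push by `c := S₀.c₄`, `g := S₀.f`).
[cite: Palasek2026ElementaryModel, §4] -/
theorem firstEpisodeD_exact_of_sliceRun_self {S₀ : Schedule TowerRates.wide} (hP : S₀.Pins 8 (6 / 5))
    (hR : S₀.Rigid) (hQ : S₀.Quiet) (s₀ : Stage 1 TowerRates.wide S₀ (Margins.routeG TowerRates.wide) 0)
    {v : ℝ → EuclideanSpace ℝ (Fin 3) → EuclideanSpace ℝ (Fin 3)} {q : ℝ → EuclideanSpace ℝ (Fin 3) → ℝ}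
    (hv : IsClassicalNSSolutionOn (Icc (S₀.τ 0) (S₀.τ 1)) 1 S₀.f v q) (hv0 : v (S₀.τ 0) = s₀.u (S₀.τ 0))
    (hEv : ∃ C : ℝ≥0∞, C < ⊤ ∧ ∀ t ∈ Icc (S₀.τ 0) (S₀.τ 1), ∫⁻ x, ‖v t x‖ₑ ^ 2 ≤ C)
    (hceil : ∀ t ∈ Icc (S₀.τ 0) (S₀.τ 1), ∀ x, ‖v t x‖ ≤ S₀.c₂ * TowerRates.wide.Y 1)
    (hletter : Letter S₀ 1 (v (S₀.τ 1))) : FirstEpisodeD (HostClass.exact S₀) :=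
  firstEpisodeD_exact_of_sliceRun hP hR s₀ S₀.c₄_le S₀.force_smooth S₀.force_decay S₀.force_silent
    S₀.push_small (fun _ _ _ => rfl) hQ hP.force_confined hv hv0 hEv hceil hletter

/-! ## §4 The rungs and the base in exact-slice form (`ε = 0`) -/

/-- **The next rung ⇔ a registered stage plus ONE SLICE RUN** (unit viscosity, wide rates, any level
`K`; the `ε = 0` twin of `rungG_succ_iff_exists_window_solution`): `RungG (K+1)` iff some pinned rigid
quiet design has a registered stage `s` at level `K` and a classical finite-energy solution of its own
system on `[τ K, τ (K+1)]` from the slice `s.u (τ K)`, below `c₂ Y_{K+1}`, with the level-`K+1` letter at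
`τ (K+1)`. [cite: Sohr2001, Ch. V Thm. 1.5.1] -/
theorem rungG_succ_iff_exists_sliceRun (K : ℕ) :
    RungG (K + 1) ↔ ∃ S : Schedule TowerRates.wide, S.Pins 8 (6 / 5) ∧ S.Rigid ∧ S.Quiet ∧
      ∃ s : Stage 1 TowerRates.wide S (Margins.routeG TowerRates.wide) K,
        ∃ (v : ℝ → EuclideanSpace ℝ (Fin 3) → EuclideanSpace ℝ (Fin 3))
          (q : ℝ → EuclideanSpace ℝ (Fin 3) → ℝ),
          IsClassicalNSSolutionOn (Icc (S.τ K) (S.τ (K + 1))) 1 S.f v q ∧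
          v (S.τ K) = s.u (S.τ K) ∧
          (∃ C : ℝ≥0∞, C < ⊤ ∧ ∀ t ∈ Icc (S.τ K) (S.τ (K + 1)), ∫⁻ x, ‖v t x‖ₑ ^ 2 ≤ C) ∧
          (∀ t ∈ Icc (S.τ K) (S.τ (K + 1)), ∀ x, ‖v t x‖ ≤ S.c₂ * TowerRates.wide.Y (K + 1)) ∧
          Letter S (K + 1) (v (S.τ (K + 1))) := by
  constructor
  · rintro ⟨S, hP, hR, hQ, ⟨s₁⟩⟩
    set s : Stage 1 TowerRates.wide S (Margins.routeG TowerRates.wide) K :=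
      s₁.restrictOfAntitone (Margins.antitone_routeG TowerRates.wide) (Nat.le_succ K) with hs
    have hss : s.Extends s₁ :=
      Stage.restrictOfAntitone_extends (Margins.antitone_routeG TowerRates.wide) s₁
    obtain ⟨hcl, h0, hE, hceil, hfloor, hstrain, hcore⟩ := Stage.Extends.sliceRun hss
    exact ⟨S, hP, hR, hQ, s, s₁.u, s₁.p, hcl, h0, hE, hceil, hfloor, hstrain, hcore⟩
  · rintro ⟨S, hP, hR, hQ, s, v, q, hv, hv0, hEv, hceil, hfloor, hstrain, hcore⟩
    obtain ⟨s', -⟩ := s.exists_extends_of_sliceRun one_pos hv hv0 hEv hceil hfloor hstrain hcore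
    exact ⟨S, hP, hR, hQ, ⟨s'⟩⟩

/-- **THE BASE ITEM IN EXACT-SLICE FORM — no hypothesis, no `ε`**: `EpisodeBaseG` (= `RungG 1`, item
19179) iff some PREPARED HOST — a pinned (`Λ = 8`, `θ = 6/5`), rigid, quiet design on the wide-base rates
with a globally anchored registered stage `s` at level `0` — launches FROM ITS SLICE `s.u τ₀` ONE RUN: a
classical finite-energy solution of the design's (forced) system on the first growth window `[τ₀, τ₁]`,
below `(5/3) Y₁`, showing at `τ₁`, in the ball, speed `≥ Y₁`, gradient `≥ A₁` and an `N₁`-core loop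
(`Letter S 1`). [cite: Palasek2026ElementaryModel, §4] [cite: Sohr2001, Ch. V Thm. 1.5.1] -/
theorem episodeBaseG_iff_exists_sliceRun_zero :
    EpisodeBaseG ↔ ∃ S : Schedule TowerRates.wide, S.Pins 8 (6 / 5) ∧ S.Rigid ∧ S.Quiet ∧
      ∃ s : Stage 1 TowerRates.wide S (Margins.routeG TowerRates.wide) 0,
        ∃ (v : ℝ → EuclideanSpace ℝ (Fin 3) → EuclideanSpace ℝ (Fin 3))
          (q : ℝ → EuclideanSpace ℝ (Fin 3) → ℝ),
          IsClassicalNSSolutionOn (Icc (S.τ 0) (S.τ 1)) 1 S.f v q ∧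
          v (S.τ 0) = s.u (S.τ 0) ∧
          (∃ C : ℝ≥0∞, C < ⊤ ∧ ∀ t ∈ Icc (S.τ 0) (S.τ 1), ∫⁻ x, ‖v t x‖ₑ ^ 2 ≤ C) ∧
          (∀ t ∈ Icc (S.τ 0) (S.τ 1), ∀ x, ‖v t x‖ ≤ S.c₂ * TowerRates.wide.Y 1) ∧
          Letter S 1 (v (S.τ 1)) :=
  rungG_one_iff.symm.trans (rungG_succ_iff_exists_sliceRun 0)

end Summit.NavierStokesRegularity.FluidComputer.PalasekTowerClayBridge

end
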